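import Literature.NumberTheory.Transcendental.DeRhamTheoremCechProofs
import Literature.NumberTheory.Transcendental.ComplexDeRhamFinite
import HarnessLib

/-!
# de Rham's theorem with complex coefficients: the named fact discharged

`Literature.NumberTheory.Transcendental.finrank_complexDeRham_eq_bettiNumber E M k`
(`dim_ℂ H^k_dR(M; ℂ) = b_k(M; ℂ)` for a compact Hausdorff `C^∞` manifold `M` modelled on a
finite-dimensional complex normed space `E`, the form of de Rham's theorem used by Hodge theory)
HOLDS: it is equivalent to the real statement `finrank_deRhamCohomology_eq_bettiNumber 𝓘(ℝ, E) M k`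
(`finrank_complexDeRham_eq_bettiNumber_of_real`, Voisin (2002), §6.1.3 Cor. 6.12), which is
`finrank_deRhamCohomology_eq_bettiNumber_of_compactSpace` (the Čech / good-cover proof of
de Rham's theorem, `DeRhamTheoremCechProofs.lean`).

* `finrank_complexDeRham_eq_bettiNumber_holds` — the discharge (exactly the fact's own binders).

## References

* C. Voisin, *Hodge Theory and Complex Algebraic Geometry I*, CUP 2002, §6.1.3 Cor. 6.12.
  [VoisinHodgeI2002]
* R. Bott, L. W. Tu, *Differential Forms in Algebraic Topology*, GTM 82, Springer 1982, Thm. 8.9,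
  Thm. 15.8. [BottTu1982Forms]
-/

open scoped Manifold ContDiff

namespace Literature.NumberTheory.Transcendental

variable (E : Type*) [NormedAddCommGroup E] [NormedSpace ℂ E] [FiniteDimensional ℂ E]
  (M : Type*) [TopologicalSpace M] [ChartedSpace E M] [IsManifold 𝓘(ℝ, E) ∞ M] [T2Space M]
  [CompactSpace M] (k : ℕ)

/-- **de Rham's theorem, complex coefficients** (`dim_ℂ H^k_dR(M; ℂ) = b_k(M; ℂ)` for every
compact Hausdorff `C^∞` manifold modelled on a finite-dimensional complex normed space): the named
fact `finrank_complexDeRham_eq_bettiNumber E M k` holds. De Rham (1931), Weil (1952); Bott–Tu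
(1982), Thm. 8.9 / 15.8; Voisin (2002), §6.1.3 Cor. 6.12 for the passage `ℝ ↝ ℂ`.
[cite: BottTu1982Forms, Thm. 15.8] [cite: VoisinHodgeI2002, §6.1.3 Cor. 6.12] -/
theorem finrank_complexDeRham_eq_bettiNumber_holds : finrank_complexDeRham_eq_bettiNumber E M k :=
  finrank_complexDeRham_eq_bettiNumber_of_real E M k
    (finrank_deRhamCohomology_eq_bettiNumber_of_compactSpace k)

end Literature.NumberTheory.Transcendental
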